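import Mathlib
import HarnessLib
import HarnessLib.Audit
import Summits.AtomisticToContinuum.Statement

/-!
Route: StatisticalGermanoSplit

CLOSED (retired) 2026-08-15T13:46:52Z by operator:999:1257524 — reason: not-a-thesis: assembly does not conclude the sub-problem Statement — note: D-0027 §2.1 audit (human 2026-08-15: routes that do not decide the summit are removed): the assembly concludes `Literature.MathematicalPhysics.KineticTheory.HydrodynamicLimit`, not the sub-problem statement; a NEW conforming route may be opened from the same idea (generated `closes : … → _root_.Hydr. The file is kept as the record of this route; refuted decls are indexed as negative knowledge (`ledger negatives`).

# Route StatisticalGermanoSplit — nature's LES converges pre-shock — kinetic-filter consistency +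
structure-function quiescence + filtered relative-entropy stability

It suffices to show X = KineticFilterConsistency ∧ MesoQuiescence ∧ FilteredEntropyStability ∧
EntropyTypicality ∧ KineticRangeControl
(realising card statistical-solutions-germano-split), which delivers the packing-guarded conjunct
HydroLimitInBand (shared item 3093);
the imported PDE item DiluteSelfConsistency (3091, owned by route ImplosionLoophole) then gives
HydrodynamicLimit. Read the hard-sphere
ensemble as nature's large-eddy simulation: U_N^ℓ := empirical (density, momentum, energy) fields
mollified at a KINETIC FILTER ℓ_N → 0 with
(N+1)ℓ_N³/log N → ∞. X1 = KineticFilterConsistency (card SS1): the weak-form hard-sphere-Euler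
residual of U_N^{ℓ_N} tends to 0 in
probability for every smooth space–time test function (by exact microscopic conservation this
residual IS the time-integrated subgrid
tensor ⟨τ_{ℓ_N}, ∇ψ⟩ — no collision vocabulary needed; "correlation-weighted mean for all bounded
cylindrical weights" is equivalent to
this in-probability form). X2 = MesoQuiescence (card SS2): the spatial L² structure function of
U_N^{ℓ_N}, time-integrated, tends to 0 as
r → 0 uniformly in N, in probability. X3 = FilteredEntropyStability (card SS3, crystallised): a
DETERMINISTIC finite-test-function
relative-entropy stability theorem for classical hs-Euler solutions among box-valued approximate
admissible fields. X4 = EntropyTypicality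
(card A4): pathwise second law in probability for the coarse-grained hard-sphere entropy at any
fixed macroscopic filter. X5 =
KineticRangeControl (card SS4): no mesoscopic vacuum / hot / dense pockets at the kinetic filter
before T, in probability.
Lean: `KineticFilterConsistency ∧ MesoQuiescence ∧ FilteredEntropyStability ∧ EntropyTypicality ∧
KineticRangeControl`

## Assembly
PhysicsToInBand (support item; the probabilistic bookkeeping of the filtered relative-entropy
argument, sketched in its block) yields
HydroLimitInBand with η₀ = min of the cruxes' bands; DiluteSelfConsistency at that η₀ supplies,
profile by profile, a σ₀ below which every
LLN-admissible classical solution obeys the packing guard; taking the minimum of the two σ₀ gives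
HydrodynamicLimit — the last step is the
pure quantifier bookkeeping already filed as ImplosionLoophole's assembly (3098), and
`assembly_of_inBand` in Sketch.lean checks the plumbing
PhysicsToInBand → (DiluteSelfConsistency → HydroLimitInBand → HydrodynamicLimit) → Assembly
sorry-free.

Rationale: WHY THIS LINE. Two technologies built for ENSEMBLES and FILTERS are transplanted with an explicit
dictionary (card): the statistical-solution framework for
hyperbolic systems (FjordholmLanthalerMishra2017; FjordholmEtAl2020: ensemble consistency +
structure-function regularity ⇒ dissipative
statistical solution, and weak–strong uniqueness collapses it to the Dirac at the classical
solution; LanthalerMishraParespulido2021 for the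
structure-function hypothesis) and the exact two-filter algebra of LES (GermanoEtAl1991;
Germano2007: Leonard tensor = weighted second-order
structure function; ConstantinETiti1994 / EyinkDrivas2018 commutator bounds). Typing the card forced
three simplifications that make the
line thin and its assembly provable: (i) the subgrid defect in weak form equals the weak-form Euler
residual of the mollified empirical
fields, so SS1 is a statement over existing declarations; (ii) the Germano identity in weak form,
Res^{ℓ₂}(ψ) = Res^{ℓ_N}(G_{ℓ₂}∗ψ) +
Leonard_{ℓ_N,ℓ₂}(ψ), is pure convolution algebra and the Leonard term is bounded by the structure
function on the range box (Taylor), so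
SS2 is exactly what kills it; (iii) pre-shock, FLMW's statistical weak–strong uniqueness reduces to
Dafermos1979/Diperna1979 relative
entropy run PATHWISE on the ℓ₂-filtered empirical fields at FIXED macroscopic ℓ₂ — no
Prokhorov/Skorokhod, no Young measures, no
weak-solution class. On the board this closing is shared in spirit with the sibling route
EntropyBookkeeping (opened in parallel today: fixed-φ
modulated-entropy Gronwall, MacroSecondLaw 4514, flux-locality cruxes 4515/4516 stated AT THE
MACROSCOPIC FILTER in the iterated limit) and
contrasts with DissipativeWeakStrong (measure-valued limits + BrezinaFeireisl2018, cruxes informal);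
what THIS route adds is the Germano split of
the macroscopic-filter closure into two typed kinetic-scale cruxes — Res^{φ}(χ) = Res^{ℓ_N}(φ∗χ) +
Leonard, so KineticFilterConsistency ∧
MesoQuiescence ∧ KineticRangeControl refine 4515/4516 (guarded form) — plus the Gronwall filed as a
typed deterministic PDE item and the explicit
packing hand-off to ImplosionLoophole. Imported areas: numerical analysis of conservation laws
(statistical solutions), turbulence/LES filter calculus, hyperbolic
PDE (relative entropy), equilibrium statistical mechanics (Georgii1994 large deviations + Liouville
invariance for the second law,
GoldsteinLebowitz2004 / GarridoGoldsteinLebowitz2004 typicality). Nearest particle-side analogue of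
the assembly: Serfaty2020 modulated
energy (mean-field, where the stress IS a functional of the empirical measure; here the collisional
closure is isolated in X1).

RANKED CRUXES. #2 KineticFilterConsistency (crux) — (card SS1, local equilibrium in its weakest
useful currency) under the packing guard ρσ³ < η₀ and for every admissible kinetic filter (φ_N ≥ 0
continuous, ∫φ_N = 1, supp ⊂ B(0,ℓ_N), φ_N ≤ A ℓ_N⁻³, Lip φ_N ≤ A ℓ_N⁻⁴, ℓ_N → 0, (N+1)ℓ_N³/log(N+2)
→ ∞): for t < T, every smooth space–time scalar test function ψ and vector test function Ψ on
[0,t]×𝕋³ and δ > 0, the local-Gibbs probability that one of the weak-form residuals on [0,t] — mass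
and energy against ψ, momentum against Ψ — of the mollified empirical fields U_N^{ℓ_N} = (ρ, m, E)
with hs fluxes (m, m⊗m/ρ + p𝟙, (E+p)m/ρ), p = hsPressure σ ρ θ(U), θ(U) = ⅔(E/ρ − |m|²/2ρ²), exceeds
δ tends to 0 (admissibility now reads: ∃A, φ_N ℓ_N³ ≤ A and |φ_N(x) − φ_N(y)| ℓ_N⁴ ≤ A·dist(x,y)).
[difficulty: open-problem] (why it might fail: It is dynamic local equilibrium (block Maxwellisation
+ equilibrium contact statistics) for deterministic hard spheres — the BoltzmannHypothesis wall; a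
persistent anisotropic kinetic stress at scale ℓ_N (as for the ideal-gas witness under shear)
refutes it.) [Spohn1991, OllaVaradhanYau1993, FjordholmLanthalerMishra2017, FjordholmEtAl2020,
Yau1991]
#3 MesoQuiescence (crux) — (card SS2, meso-quiescence = uniform structure-function decay) same
prefix and filters: for t < T and ε > 0 there are r > 0 and N₀ such that for all N ≥ N₀ and all
torus shifts h with |h| < r, the local-Gibbs probability that ∫₀ᵗ∫_{𝕋³} |U_N^{ℓ_N}(s,x+h) −
U_N^{ℓ_N}(s,x)|² dx ds > ε is < ε (no N-independent energy between the kinetic and the macroscopic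
scale; via Germano2007 / ConstantinETiti1994 this is exactly Leonard_{ℓ_N,ℓ₂} → 0). [difficulty: XL]
(why it might fail: An N-independent mesoscale energy plateau before T (thermal seeds ~N^{-1/2}
amplified at effective Reynolds ~N^{1/3} faster than the smooth profile's e^{γt}, i.e. pre-shock
spontaneous stochasticity) breaks the r → 0 limit; MD-visible at N = 10⁴–10⁶.) [Germano2007,
doi:10.1063/1.2714078, LanthalerMishraParespulido2021, EyinkDrivas2018,
doi:10.1103/physrevx.8.011022, ConstantinETiti1994, EyinkPeng2025]
#4 FilteredEntropyStability (crux) — (card SS3 crystallised; deterministic PDE) ∃ η₀ > 0: for every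
σ > 0, every classical hs-Euler solution Ū = (ρ̄, ρ̄ū, Ē) on [0,T), t < T and every box K = {c ≤ ρ ≤
C_ρ, |m| ≤ C, E ≤ C, θ(U) ≥ c} with C_ρσ³ < η₀ containing range Ū|[0,t] strictly: ∀ ε ∃ δ and
finitely many smooth test functions (Ψ^ρ_i, Ψ^E_i, Ψ^m_i) on [0,t]×𝕋³ such that any jointly
measurable K-valued V = (V^ρ, V^m, V^E) with ‖V(0) − Ū(0)‖²_{L²} ≤ δ, ∫η(V(s)) ≤ ∫η(Ū(0)) + δ (η =
−ρ s_hs, s_hs = 3/2 log θ − log ρ − hsExcessFreeEnergy(ρσ³)) and weak-form residuals against the Ψ_i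
of modulus ≤ δ on every [0,s] satisfies ‖V(s) − Ū(s)‖²_{L²} ≤ ε for all s ≤ t (Dafermos relative
entropy with Ψ = Dη(Ū); Gronwall). [deps: HsEosLowDensity] [difficulty: M] (why it might fail: Needs
UNIFORM (positive-Hessian, not just strict) convexity of −ρs_hs and C² fluxes on K — true only at
packing < η₀ via HsEosLowDensity; deriv of the limsup-defined f_ex and derivWithin at t-endpoints
must be junk-free on K×[0,t].) [Dafermos1979, Diperna1979, BrezinaFeireisl2018, FjordholmEtAl2020,
FeireislNovotny2012]
#5 EntropyTypicality (crux) — (card A4, pathwise second law in probability) same guarded prefix; for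
every FIXED continuous kernel G ≥ 0 with ∫G = 1, t < T, δ > 0 and dilute box (c, C_ρ, C) with C_ρσ³
< η₀: the local-Gibbs probability that the G-mollified empirical fields at time t lie in the box
everywhere AND their coarse-grained hard-sphere entropy ∫ρ_G(3/2 log θ_G − log ρ_G − f_ex(ρ_Gσ³)) is
below the initial macroscopic entropy ∫ρ̄₀(3/2 log θ̄₀ − log ρ̄₀ − f_ex(ρ̄₀σ³)) − δ tends to 0.
Mechanism: Boltzmann–Einstein typicality — static large deviations of coarse-grained (ρ,m,E)
profiles under the flow-INVARIANT canonical Gibbs measure (rate βE − S_hs), transferred to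
local-Gibbs data using dP₀/dλ = exp((N+1)·linear functional of the initial empirical fields) and
pathwise energy conservation (exponent gap = δ). Differs from EntropyBookkeeping.MacroSecondLaw
(stmt-4514): specialised to the flow map, boxed (dilute) instead of density-floored, and benchmarked
on the Euler data (ρ,u,θ)(0) so that no local-Gibbs LLN fact is needed in the assembly; 4514
together with localGibbs_lln implies it, so either closes X4. [difficulty: L] (why it might fail:
Needs the LD upper bound for coarse-grained (ρ,m,E) profiles of the canonical hard-sphere gas on
dilute boxes with rate βE − S_hs (Georgii1994-type) plus a slab-partition transfer to local-Gibbs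
tilts; any leak in the exponent bookkeeping (momentum shells, kernel G) must stay below δ.)
[Georgii1994, GoldsteinLebowitz2004, GarridoGoldsteinLebowitz2004,
doi:10.1103/physrevlett.92.050602, Ruelle1969, LebowitzPenrose1964, Lanford1975]
#6 KineticRangeControl (crux) — (card SS4, tails) for every target band η₀ > 0 and profiles ∃ σ₀ ∀ σ
< σ₀, for every guarded classical solution, admissible kinetic filter and t < T there are 0 < c,
C_ρ, C with C_ρσ³ < η₀, the classical solution strictly inside the box on [0,t], and local-Gibbs
probability → 1 that the mollified empirical fields U_N^{ℓ_N}(s,x) stay in the box {c ≤ ρ ≤ C_ρ, |m|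
≤ C, E ≤ C, θ ≥ c} for ALL s ≤ t and x ∈ 𝕋³ (no mesoscopic vacuum, hot or dense pockets are created
by the dynamics before T). [difficulty: XL] (why it might fail: A sup over (s,x) of block
observables at scale ℓ_N is a DYNAMIC moderate-deviation statement: static typicality only reaches
events rarer than exp(−N·I(U₀)) while block tails are exp(−cNℓ_N³); one transient pocket of size ℓ_N
with non-vanishing probability refutes it.) [Spohn1991, OllaVaradhanYau1993, KipnisLandim1999,
GarridoGoldsteinLebowitz2004, doi:10.1103/physrevlett.92.050602]
#9 HsEosLowDensity (support) — (shared, = stmt-AtomisticToContinuum-0768) hard-sphere equation of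
state at low density: f_ex analytic on (−η₀, η₀), agrees with hsExcessFreeEnergy on [0,η₀), F(0)=0,
F′(0)=2π/3, and the canonical limit exists; the EOS input of FilteredEntropyStability (C² fluxes,
uniform convexity of −ρs_hs at small packing). [difficulty: L] [Ruelle1969, LebowitzPenrose1964]
#9 DiluteSelfConsistency (support) — (shared, = stmt-AtomisticToContinuum-3091, owned as a crux by
route ImplosionLoophole; NOT staffed here) for every η > 0 and profiles ∃ σ₀ ∀ σ < σ₀: every
LLN-admissible classical hs-Euler solution keeps packing ρ_t(x)σ³ < η on [0,T) — the σ-uniform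
density bound that turns HydroLimitInBand into HydrodynamicLimit. [difficulty: open-problem]
[Sideris1985, Spohn1991, Kato1975]
#9 HydroLimitInBand (support) — (shared, = stmt-AtomisticToContinuum-3093) the packing-guarded
conjunct: ∃ η₀ > 0 ∀ profiles ∃ σ₀ ∀ σ < σ₀ ∀ classical solutions with ρ_tσ³ < η₀ on [0,T)×𝕋³ ∀
flows, LLN at t = 0 ⇒ LLN at every t < T. It is what this route's physics delivers
(PhysicsToInBand). [difficulty: open-problem] [Spohn1991, OllaVaradhanYau1993]
#9 PhysicsToInBand (support) — (this route's assembly proper; provable now from the five cruxes,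
standard but long) KineticFilterConsistency → MesoQuiescence → FilteredEntropyStability →
EntropyTypicality → KineticRangeControl → HydroLimitInBand. Proof plan: fix ε; FES gives δ and test
functions Ψ_i = Dη(Ū)-type; choose an even bump G = G_{ℓ₂} with ℓ₂ so small that ‖Ū₀∗G − Ū₀‖ and the
MesoQuiescence radius are below δ; run FES pathwise on V = U_N^{ℓ_N}∗G on the intersection of the
good events: residuals of V against Ψ_i = residuals of U_N^{ℓ_N} against G∗Ψ_i (Germano, KFC) +
Leonard terms ≤ C_K·structure function (Taylor on the box, MQ, Fubini/Markov in (h,h′)); entropy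
from ET at kernel φ_{ℓ_N}∗G ≈ G; box from KRC (convexity of the box under averaging); initial term
from the LLN hypothesis; then ‖V(t) − Ū(t)‖_{L²} ≤ ε w.h.p. and testing against continuous χ
(uniform continuity, mass/energy bounds) gives TendstoHydroFieldsAt; η₀ := min of the cruxes' η₀, σ₀
:= min of their σ₀. [deps: KineticFilterConsistency, MesoQuiescence, FilteredEntropyStability,
EntropyTypicality, KineticRangeControl, HydroLimitInBand] [difficulty: L] [FjordholmEtAl2020,
Germano2007, doi:10.1063/1.2714078, Dafermos1979, ConstantinETiti1994]

TWO-LAYER PLAN. Foreseen glued splits (none filed now): KineticFilterConsistency ⇐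
KineticStressIsotropy (kinetic part of τ_{ℓ_N}: block second velocity
moments isotropic with trace fixed by E − |m|²/2ρ, in probability) → ContactVirial (collisional
momentum/energy transfer at scale ℓ_N equals
ρθ(Z(ρσ³) − 1) in weak form: mesoscopic virial theorem, Spohn1991 (3.15)) →
KineticFilterConsistency; the glue is the exact microscopic
balance law for mollified empirical fields (Irving–Kirkwood/Hardy form) and is provable now.
MesoQuiescence ⇐ ThermalFloor (static: S²_r ≤
C‖∇Ū‖²r² + C/(Nℓ_N³) under local Gibbs laws) → NoMesoscaleAmplification (dynamic: linearised-Euler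
growth e^{γt} of N^{-1/2} seeds) →
MesoQuiescence. EntropyTypicality ⇐ StaticProfileLDP (Georgii1994-type upper bound on dilute boxes)
→ InvarianceTransfer (Liouville +
energy conservation + slab partition of the local-Gibbs tilt) → EntropyTypicality. PhysicsToInBand
may be split into GermanoWeakForm
(convolution algebra + Leonard ≤ C_K S²) → FilteredGronwallInProbability → PhysicsToInBand if a
prover asks.

KILL CRITERIA. ¬MesoQuiescence exhibited (an N-independent mesoscale energy plateau before T, by
theorem or by a certified MD computation the refuters
accept) closes the route `refuted:MesoQuiescence` and would be major news (pre-shock spontaneous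
stochasticity) — hand it to card
ehrenfest-horizon-instability. ¬KineticFilterConsistency for some smooth dilute pre-shock data
refutes every flux-closure route at once
(DissipativeWeakStrong's FluxClosure 0823 included) and strongly suggests ¬HydroLimitInBand: file it
as a statement. ¬KineticRangeControl
alone forces a pivot: restate X1/X2/X4 on the range event and replace the box by uniform
integrability (FLMW's (A1)) — FES then needs the
relative-energy (Feireisl) form instead of Dafermos on a compact box. FilteredEntropyStability
cannot be refuted in substance (theorem-grade);
a Lean-junk refutation is repaired by restating. DenseExcursion (ImplosionLoophole 3090) proved ⇒
DiluteSelfConsistency refuted ⇒ this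
route still delivers HydroLimitInBand; re-target the Assembly to the guarded conjunct with the
operator. MacroSecondLaw (4514) proved together with localGibbs_lln closes X4 by specialisation;
EntropyBookkeeping's flux-locality cruxes 4515/4516 proved directly would moot X1 ∧ X2 as a pair
(the split then only assigns credit).
HydroLimitInBand proved elsewhere moots the physics half; HydrodynamicLimit proved elsewhere moots
the route.

NOT DECOMPOSED YET. The kinetic/collisional split of X1 (needs the mollified balance-law lemma
first); the static-vs-dynamic split of X2 and X5; the LDP
behind X4; constants (η₀ bands, box margins, the rate in (N+1)ℓ³/log N); the existence of admissible
filter families and even bumps on 𝕋³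
(elementary, rides with PhysicsToInBand via --supports); uniform-integrability variants of X5;
anything post-shock (statistical solutions
may be non-Dirac there — outlook of the card, not claimed).

CHEAPEST FALSIFIER. Pen-and-paper calibration on the two catalogued kernels, then one lookup. (a)
Ideal gas (BoltzmannHypothesis kernel, free flight of a
sheared local Maxwellian): X2, X4, X5 hold (free streaming keeps mollified fields smooth and in the
box; entropy of coarse-grained free flow
does not drop) while X1 FAILS (kinetic stress stays anisotropic ∝ t·|∇u|) — checked by hand: the
split assigns blame to X1, as it must; if
instead X2 failed for the ideal gas the route is mis-designed. (b) Lookup done: FLMW 2020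
(FjordholmEtAl2020) prove weak–strong uniqueness of
dissipative statistical solutions only for systems with uniformly convex entropy and Dirac data at
Lipschitz solutions — matching the
compact-box form of FES rather than an energy-class form; hence FES is stated on boxes and X5
carries the range. (c) The MD test of X2
(structure functions of block momentum fields at φ = 0.05, N = 10⁴–10⁶, decaying shear + sound pulse
collapsing on C r² + C/(Nr³)) is the
cheapest EMPIRICAL kill; not run here (kit not in this unit's payload).

NUMBERS. Filters: ℓ_N → 0 with (N+1)ℓ_N³/log(N+2) → ∞ (below that, vacuum pockets exist already at t
= 0: expected number of empty ℓ-blocks ≈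
ℓ⁻³e^{−ρNℓ³} ↛ 0); mean free path ≈ N^{-1/3}/(√2πσ²), so admissible filters sit above it by
construction. Thermal floor of the structure
function ≈ θ/(ρ(N+1)ℓ_N³) → 0. Second virial coefficient: Z(η) = 1 + (2π/3)η + O(η²)
(HsEosLowDensity), so (ηZ)′ > 0 and −ρs_hs is
uniformly convex for η < η₀ small. Effective Reynolds number of the particle flow ≈ N^{1/3}
(viscosity ∼ mean free path × thermal speed).
Items at open: 10 (5 cruxes, 4 support, 1 assembly).

DEFINITION REQUESTS. None needed to state the items (mollified empirical fields, residuals,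
entropies are spelled out inline over HardSphereEuler.lean and
TorusCalculus.lean). Nice-to-have, not filed: a Literature notion `TorusMollifier` (admissible
kernel families on UnitAddTorus) and
`empiricalStressField` (kinetic + collisional momentum flux as a matrix-valued measure) — the latter
is what the foreseen split of X1 needs;
it coincides with the pending definition request of DissipativeWeakStrong's FluxClosure (0823).

Novelty: Searches (2026-08-15): `lit search --source crossref "statistical solutions hyperbolic conservation
laws Fjordholm Lanthaler Mishra"` (11:
doi:10.1007/s00205-017-1145-9, doi:10.1142/s0218202520500141, doi:10.1137/17m1154874,
doi:10.1007/s10208-015-9299-z, no particle systems);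
`lit search --source crossref "large deviations equivalence of ensembles Gibbsian particle systems
Georgii"` (10: doi:10.1007/bf01199021,
doi:10.1007/bf02179874); `lit search --source crossref "Boltzmann entropy nonequilibrium typicality
Goldstein Lebowitz"` (10:
doi:10.1016/j.physd.2004.01.008, doi:10.1103/physrevlett.92.050602, doi:10.1007/s10955-024-03311-x);
`lit search --source crossref "modulated
energy mean field limit Serfaty"` (10: doi:10.1215/00127094-2020-0019, doi:10.5802/slsedp.135); `lit
galaxy search "Germano identity" --star all`
(8 pdf hits, all engineering LES: Meneveau–Lund–Cabot 1994, dynamic SGS models; no kinetic theory);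
`lit galaxy search "dissipative statistical
solutions" --star all` (2: arXiv:1912.04323, an ETH SAM report); `lit galaxy search "statistical
solutions of the compressible Euler equations"
/ "hydrodynamic limit hard spheres relative entropy coarse-grained" --star all` (0); `lit frontier
AtomisticToContinuum --since 2020` (30 rows;
hydro-relevant: arXiv:2310.13338 heat equation from deterministic dynamics, arXiv:2602.04407 DHM
exposition — none on statistical solutions);
`lit bridges AtomisticToContinuum --cross any` (Golse doi:10.1090/bull/1650 survey only); the 9  [refs: 10.1007/s00205-017-1145-9, 10.1142/s0218202520500141, 10.1137/17m1154874, 10.1007/s10208-015-9299-z, 10.1007/bf01199021, 10.1007/bf02179874, 10.1016/j.physd.2004.01.008, 10.1103/physrevlett.92.050602, 10.1007/s10955-024-03311-x, 10.1215/00127094-2020-0019, 10.5802/slsedp.135, 10.1090/bull/1650, 10.1103/physrevx.8.011022, 1912.04323, 2310.13338, 2602.04407, doi:10.1007/s00205-017-1145-9, doi:10.114]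

Barriers (technique_class: statistical-solutions LES-filter-identity weak-strong): - technique_class: statistical-solutions LES-filter-identity weak-strong
- Literature.Barriers.AtomisticToContinuum.BoltzmannHypothesisBarrier: it does not evade it; the bet
is that the ergodic content is isolated in ONE typed crux (KineticFilterConsistency) in its weakest
useful currency (weak form, in probability, pre-shock, dilute guard), calibrated on the barrier's
kernel: the ideal gas passes X2/X4/X5 and fails X1.
- Literature.Barriers.AtomisticToContinuum.WildSolutionsBarrier: identification is by relative
entropy against the CLASSICAL solution for t < T from LLN (Dirac) data, where admissible wild
solutions do not compete; nothing post-shock is claimed.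
- Literature.Barriers.AtomisticToContinuum.ShockFormationBarrier: respected — everything is
quantified over t < T, T a classical existence time; FES uses smoothness of Ū on [0,t].
- Literature.Barriers.AtomisticToContinuum.NoBVEstimatesMultiDBarrier: no BV or Lᵖ (p ≠ 2) stability
is used; compactness-type input is the L² structure function of the ENSEMBLE (X2) and stability is
L²-relative-entropy against a smooth solution, outside Rauch's class.
- Literature.Barriers.AtomisticToContinuum.HighMomentumCutoffBarrier: enters only through the box of
X5 (energy density ≤ C at scale ℓ_N, in probability), flagged as a crux, not assumed.
- Literature.Barriers.AtomisticToContinuum.VelocityReversalBarrier: all statements are laws of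
mollified fields under the local-Gibbs ensemble, in probability; no phase-point or every-datum cla

History (route lifecycle, newest last):
- 2026-08-15T13:46:52Z · CLOSED retired — not-a-thesis: assembly does not conclude the sub-problem Statement (operator:999:1257524)

sub-problem: HydrodynamicLimit · status: closed(retired) · opened planner-plancard-AtomisticToContinuum-Hydrody-1f589952-0 2026-08-15T11:56:12Z · rev 0 · ledger route-AtomisticToContinuum-StatisticalGermanoSplit
GENERATED by the gate from the ledger (D-0016/17). Provers cite these decls: `theorem foo : Summit.AtomisticToContinuum.HydrodynamicLimit.Theses.StatisticalGermanoSplit.<Decl> := …` in Summits/AtomisticToContinuum/HydrodynamicLimit/Theorems/<Name>.lean.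
-/

namespace Summit.AtomisticToContinuum.HydrodynamicLimit.Theses.StatisticalGermanoSplit

open scoped BigOperators Topology Manifold Classical MeasureTheory ProbabilityTheory Matrix InnerProductSpace ComplexConjugate ContinuousMap
open Filter Set Function TopologicalSpace MeasureTheory

attribute [summit_statement] _root_.HydrodynamicLimit

/-- item stmt-AtomisticToContinuum-6953 · crux · rank 2 · closed · moot by None · by planner
why it might fail: It is dynamic local equilibrium (block Maxwellisation + equilibrium contact statistics) for deterministic hard spheres — the BoltzmannHypothesis wall; a persistent anisotropic kinetic stress at scale ℓ_N (as for the ideal-gas witness under shear) refutes it.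
sources: Spohn1991, OllaVaradhanYau1993, FjordholmLanthalerMishra2017, FjordholmEtAl2020, Yau1991
[crux] (card SS1, local equilibrium in its weakest useful currency) under the packing guard ρσ³ < η₀
and for every admissible kinetic filter (φ_N ≥ 0 continuous, ∫φ_N = 1, supp ⊂ B(0,ℓ_N), φ_N ≤ A
ℓ_N⁻³, Lip φ_N ≤ A ℓ_N⁻⁴, ℓ_N → 0, (N+1)ℓ_N³/log(N+2) → ∞): for t < T, every smooth space–time
scalar test function ψ and vector test function Ψ on [0,t]×𝕋³ and δ > 0, the local-Gibbs probability
that one of the weak-form residuals on [0,t] — mass and energy against ψ, momentum against Ψ — of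
the mollified empirical fields U_N^{ℓ_N} = (ρ, m, E) with hs fluxes (m, m⊗m/ρ + p𝟙, (E+p)m/ρ), p =
hsPressure σ ρ θ(U), θ(U) = ⅔(E/ρ − |m|²/2ρ²), exceeds δ tends to 0 (admissibility now reads: ∃A,
φ_N ℓ_N³ ≤ A and |φ_N(x) − φ_N(y)| ℓ_N⁴ ≤ A·dist(x,y)). [difficulty: open-problem] -/
@[route_item "route-AtomisticToContinuum-StatisticalGermanoSplit"]
def KineticFilterConsistency : Prop :=
  ∃ η₀ : ℝ, 0 < η₀ ∧ ∀ (a₀ θ₀ : Literature.MathematicalPhysics.KineticTheory.T3 → ℝ) (u₀ : Literature.MathematicalPhysics.KineticTheory.T3 → Literature.MathematicalPhysics.KineticTheory.V3), Continuous a₀ → Continuous θ₀ → Continuous u₀ → (∀ x, 0 < a₀ x) → (∀ x, 0 < θ₀ x) → ∃ σ₀ : ℝ, 0 < σ₀ ∧ ∀ σ : ℝ, 0 < σ → σ < σ₀ → ∀ (T : ℝ) (ρ θ : ℝ → Literature.MathematicalPhysics.KineticTheory.T3 → ℝ) (u : ℝ → Literature.MathematicalPhysics.KineticTheory.T3 →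 Literature.MathematicalPhysics.KineticTheory.V3), Literature.MathematicalPhysics.KineticTheory.IsHardSphereEulerSolution σ T ρ u θ → (∀ t ∈ Set.Ico 0 T, ∀ x, ρ t x * σ ^ 3 < η₀) → ∀ Φ : (N : ℕ) → Literature.Analysis.FluidPDE.HardSphereFlow (Literature.Analysis.FluidPDE.Torus.geometry (Fin 3)) (Literature.MathematicalPhysics.KineticTheory.hsDiameter σ N) (N + 1), Literature.MathematicalPhysics.KineticTheory.TendstoHydroFieldsAt (fun N => Literature.MathematicalPhysics.KineticTheory.localGibbsLaw σ a₀ u₀ θ₀ N (Φ N)) Φ ρ u θ 0 → ∀ (φ : ℕ → Literature.MathematicalPhysics.KineticTheory.T3 → ℝ) (ℓ : ℕ → ℝ), (∀ N, Continuous (φ N)) → (∀ N x, 0 ≤ φ N x) → (∀ N, ∫ x, φ N x = 1) → (∀ N x, ℓ N < Literature.Analysis.FluidPDE.Torus.euclidDist x 0 → φ N x = 0) → (∃ A : ℝ, ∀ N x y, φ N x * ℓ N ^ 3 ≤ A ∧ |φ N x - φ N y| * ℓ N ^ 4 ≤ A * Literature.Analysis.FluidPDE.Torus.euclidDist x y)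 → (∀ N, 0 < ℓ N) → Filter.Tendsto ℓ Filter.atTop (nhds 0) → Filter.Tendsto (fun N : ℕ => ((N : ℝ) + 1) * ℓ N ^ 3 / Real.log ((N : ℝ) + 2)) Filter.atTop Filter.atTop → ∀ t ∈ Set.Ico 0 T, ∀ (ψ : ℝ → Literature.MathematicalPhysics.KineticTheory.T3 → ℝ) (Ψ : ℝ → Literature.MathematicalPhysics.KineticTheory.T3 → Literature.MathematicalPhysics.KineticTheory.V3), Literature.Analysis.FunctionSpaces.Torus.IsSmoothSpaceTimeOn (Set.Icc 0 t) ψ → Literature.Analysis.FunctionSpaces.Torus.IsSmoothSpaceTimeOn (Set.Icc 0 t) Ψ → ∀ δ : ℝ, 0 < δ → Filter.Tendsto (fun N : ℕ => Literature.MathematicalPhysics.KineticTheory.localGibbsLaw σ a₀ u₀ θ₀ N (Φ N) {z | let ρℓ := fun s x => Literature.MathematicalPhysics.KineticTheory.empiricalDensityField ((Φ N).flow s z) (fun y => φ N (x - y)); let mℓ := fun s x => Literature.MathematicalPhysics.KineticTheory.empiricalMomentumField ((Φ N).flow s z) (fun y => φ N (x - y)); let Eℓ := fun s x => Literature.MathematicalPhysics.KineticTheory.empiricalEnergyField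 ((Φ N).flow s z) (fun y => φ N (x - y)); let θℓ := fun s x => 2 / 3 * (Eℓ s x / ρℓ s x - ‖mℓ s x‖ ^ 2 / (2 * ρℓ s x ^ 2)); let pℓ := fun s x => Literature.MathematicalPhysics.KineticTheory.hsPressure σ (ρℓ s x) (θℓ s x); δ < |(∫ x, ρℓ t x * ψ t x) - (∫ x, ρℓ 0 x * ψ 0 x) - ∫ s in (0 : ℝ)..t, ∫ x, (ρℓ s x * Literature.Analysis.FunctionSpaces.Torus.timeDerivWithin (Set.Icc 0 t) ψ s x + inner ℝ (mℓ s x) (Literature.Analysis.FunctionSpaces.Torus.gradient (ψ s) x))| ∨ δ < |(∫ x, Eℓ t x * ψ t x) - (∫ x, Eℓ 0 x * ψ 0 x) - ∫ s in (0 : ℝ)..t, ∫ x, (Eℓ s x * Literature.Analysis.FunctionSpaces.Torus.timeDerivWithin (Set.Icc 0 t) ψ s x + (Eℓ s x + pℓ s x) / ρℓ s x * inner ℝ (mℓ s x) (Literature.Analysis.FunctionSpaces.Torus.gradient (ψ s) x))| ∨ δ < |(∫ x, inner ℝ (mℓ t x) (Ψ t x)) - (∫ x, inner ℝ (mℓ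 0 x) (Ψ 0 x)) - ∫ s in (0 : ℝ)..t, ∫ x, (inner ℝ (mℓ s x) (Literature.Analysis.FunctionSpaces.Torus.timeDerivWithin (Set.Icc 0 t) Ψ s x) + inner ℝ (mℓ s x) (Literature.Analysis.FunctionSpaces.Torus.fderiv (Ψ s) x (mℓ s x)) / ρℓ s x + pℓ s x * Literature.Analysis.FunctionSpaces.Torus.divergence (Ψ s) x)|}) Filter.atTop (nhds 0)

/-- item stmt-AtomisticToContinuum-6954 · crux · rank 3 · closed · moot by None · by planner
why it might fail: An N-independent mesoscale energy plateau before T (thermal seeds ~N^{-1/2} amplified at effective Reynolds ~N^{1/3} faster than the smooth profile's e^{γt}, i.e. pre-shock spontaneous stochasticity) breaks the r → 0 limit; MD-visible at N = 10⁴–10⁶.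
sources: Germano2007, doi:10.1063/1.2714078, LanthalerMishraParespulido2021, EyinkDrivas2018, doi:10.1103/physrevx.8.011022, ConstantinETiti1994
[crux] (card SS2, meso-quiescence = uniform structure-function decay) same prefix and filters: for t
< T and ε > 0 there are r > 0 and N₀ such that for all N ≥ N₀ and all torus shifts h with |h| < r,
the local-Gibbs probability that ∫₀ᵗ∫_{𝕋³} |U_N^{ℓ_N}(s,x+h) − U_N^{ℓ_N}(s,x)|² dx ds > ε is < ε (no
N-independent energy between the kinetic and the macroscopic scale; via Germano2007 /
ConstantinETiti1994 this is exactly Leonard_{ℓ_N,ℓ₂} → 0). [difficulty: XL] -/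
@[route_item "route-AtomisticToContinuum-StatisticalGermanoSplit"]
def MesoQuiescence : Prop :=
  ∃ η₀ : ℝ, 0 < η₀ ∧ ∀ (a₀ θ₀ : Literature.MathematicalPhysics.KineticTheory.T3 → ℝ) (u₀ : Literature.MathematicalPhysics.KineticTheory.T3 → Literature.MathematicalPhysics.KineticTheory.V3), Continuous a₀ → Continuous θ₀ → Continuous u₀ → (∀ x, 0 < a₀ x) → (∀ x, 0 < θ₀ x) → ∃ σ₀ : ℝ, 0 < σ₀ ∧ ∀ σ : ℝ, 0 < σ → σ < σ₀ → ∀ (T : ℝ) (ρ θ : ℝ → Literature.MathematicalPhysics.KineticTheory.T3 → ℝ) (u : ℝ → Literature.MathematicalPhysics.KineticTheory.T3 → Literature.MathematicalPhysics.KineticTheory.V3), Literature.MathematicalPhysics.KineticTheory.IsHardSphereEulerSolution σ T ρ u θ → (∀ t ∈ Set.Ico 0 T, ∀ x, ρ t x * σ ^ 3 < η₀) → ∀ Φ : (N : ℕ) → Literature.Analysis.FluidPDE.HardSphereFlow (Literature.Analysis.FluidPDE.Torus.geometry (Fin 3)) (Literature.MathematicalPhysics.KineticTheory.hsDiameter σ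 N) (N + 1), Literature.MathematicalPhysics.KineticTheory.TendstoHydroFieldsAt (fun N => Literature.MathematicalPhysics.KineticTheory.localGibbsLaw σ a₀ u₀ θ₀ N (Φ N)) Φ ρ u θ 0 → ∀ (φ : ℕ → Literature.MathematicalPhysics.KineticTheory.T3 → ℝ) (ℓ : ℕ → ℝ), (∀ N, Continuous (φ N)) → (∀ N x, 0 ≤ φ N x) → (∀ N, ∫ x, φ N x = 1) → (∀ N x, ℓ N < Literature.Analysis.FluidPDE.Torus.euclidDist x 0 → φ N x = 0) → (∃ A : ℝ, ∀ N x y, φ N x * ℓ N ^ 3 ≤ A ∧ |φ N x - φ N y| * ℓ N ^ 4 ≤ A * Literature.Analysis.FluidPDE.Torus.euclidDist x y) → (∀ N, 0 < ℓ N) → Filter.Tendsto ℓ Filter.atTop (nhds 0) → Filter.Tendsto (fun N : ℕ => ((N : ℝ) + 1) * ℓ N ^ 3 / Real.log ((N : ℝ) + 2)) Filter.atTop Filter.atTop → ∀ t ∈ Set.Ico 0 T, ∀ ε : ℝ, 0 < ε → ∃ r : ℝ, 0 < r ∧ ∃ N₀ : ℕ, ∀ N ≥ N₀, ∀ h : Literature.MathematicalPhysics.KineticTheory.T3,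 Literature.Analysis.FluidPDE.Torus.euclidDist h 0 < r → Literature.MathematicalPhysics.KineticTheory.localGibbsLaw σ a₀ u₀ θ₀ N (Φ N) {z | let ρℓ := fun s x => Literature.MathematicalPhysics.KineticTheory.empiricalDensityField ((Φ N).flow s z) (fun y => φ N (x - y)); let mℓ := fun s x => Literature.MathematicalPhysics.KineticTheory.empiricalMomentumField ((Φ N).flow s z) (fun y => φ N (x - y)); let Eℓ := fun s x => Literature.MathematicalPhysics.KineticTheory.empiricalEnergyField ((Φ N).flow s z) (fun y => φ N (x - y)); ε < ∫ s in (0 : ℝ)..t, ∫ x, ((ρℓ s (x + h) - ρℓ s x) ^ 2 + ‖mℓ s (x + h) - mℓ s x‖ ^ 2 + (Eℓ s (x + h) - Eℓ s x) ^ 2)} < ENNReal.ofReal ε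

/-- item stmt-AtomisticToContinuum-6955 · crux · rank 4 · closed · moot by None · by planner
why it might fail: Needs UNIFORM (positive-Hessian, not just strict) convexity of −ρs_hs and C² fluxes on K — true only at packing < η₀ via HsEosLowDensity; deriv of the limsup-defined f_ex and derivWithin at t-endpoints must be junk-free on K×[0,t].
sources: Dafermos1979, Diperna1979, BrezinaFeireisl2018, FjordholmEtAl2020, FeireislNovotny2012
[crux] (card SS3 crystallised; deterministic PDE) ∃ η₀ > 0: for every σ > 0, every classical
hs-Euler solution Ū = (ρ̄, ρ̄ū, Ē) on [0,T), t < T and every box K = {c ≤ ρ ≤ C_ρ, |m| ≤ C, E ≤ C,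
θ(U) ≥ c} with C_ρσ³ < η₀ containing range Ū|[0,t] strictly: ∀ ε ∃ δ and finitely many smooth test
functions (Ψ^ρ_i, Ψ^E_i, Ψ^m_i) on [0,t]×𝕋³ such that any jointly measurable K-valued V = (V^ρ, V^m,
V^E) with ‖V(0) − Ū(0)‖²_{L²} ≤ δ, ∫η(V(s)) ≤ ∫η(Ū(0)) + δ (η = −ρ s_hs, s_hs = 3/2 log θ − log ρ −
hsExcessFreeEnergy(ρσ³)) and weak-form residuals against the Ψ_i of modulus ≤ δ on every [0,s]
satisfies ‖V(s) − Ū(s)‖²_{L²} ≤ ε for all s ≤ t (Dafermos relative entropy with Ψ = Dη(Ū);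
Gronwall). [deps: HsEosLowDensity] [difficulty: M] -/
@[route_item "route-AtomisticToContinuum-StatisticalGermanoSplit"]
def FilteredEntropyStability : Prop :=
  ∃ η₀ : ℝ, 0 < η₀ ∧ ∀ σ : ℝ, 0 < σ → ∀ (T : ℝ) (ρ θ : ℝ → Literature.MathematicalPhysics.KineticTheory.T3 → ℝ) (u : ℝ → Literature.MathematicalPhysics.KineticTheory.T3 → Literature.MathematicalPhysics.KineticTheory.V3), Literature.MathematicalPhysics.KineticTheory.IsHardSphereEulerSolution σ T ρ u θ → ∀ t ∈ Set.Ico 0 T, ∀ (c Cρ C : ℝ), 0 < c → Cρ * σ ^ 3 < η₀ → (∀ s ∈ Set.Icc 0 t, ∀ x, c < ρ s x ∧ ρ s x < Cρ ∧ ‖ρ s x • u s x‖ < C ∧ Literature.MathematicalPhysics.KineticTheory.totalEnergyDensity (ρ s x) (u s x) (θ s x) < C ∧ c < θ s x) → ∀ ε : ℝ, 0 < ε → ∃ δ : ℝ, 0 < δ ∧ ∃ (k : ℕ) (Ψρ ΨE : Fin k → ℝ → Literature.MathematicalPhysics.KineticTheory.T3 → ℝ) (Ψm : Fin k → ℝ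 → Literature.MathematicalPhysics.KineticTheory.T3 → Literature.MathematicalPhysics.KineticTheory.V3), (∀ i, Literature.Analysis.FunctionSpaces.Torus.IsSmoothSpaceTimeOn (Set.Icc 0 t) (Ψρ i) ∧ Literature.Analysis.FunctionSpaces.Torus.IsSmoothSpaceTimeOn (Set.Icc 0 t) (ΨE i) ∧ Literature.Analysis.FunctionSpaces.Torus.IsSmoothSpaceTimeOn (Set.Icc 0 t) (Ψm i)) ∧ ∀ (Vρ VE : ℝ → Literature.MathematicalPhysics.KineticTheory.T3 → ℝ) (Vm : ℝ → Literature.MathematicalPhysics.KineticTheory.T3 → Literature.MathematicalPhysics.KineticTheory.V3), Measurable (Function.uncurry Vρ) → Measurable (Function.uncurry VE) → Measurable (Function.uncurry Vm) → let Vθ : ℝ → Literature.MathematicalPhysics.KineticTheory.T3 → ℝ := fun s x => 2 / 3 * (VE s x / Vρ s x - ‖Vm s x‖ ^ 2 / (2 * Vρ s x ^ 2)); let Vp : ℝ → Literature.MathematicalPhysics.KineticTheory.T3 → ℝ := fun s x => Literature.MathematicalPhysics.KineticTheory.hsPressure σ (Vρ s x) (Vθ s x); (∀ s ∈ Set.Icc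 0 t, ∀ x, c ≤ Vρ s x ∧ Vρ s x ≤ Cρ ∧ ‖Vm s x‖ ≤ C ∧ VE s x ≤ C ∧ c ≤ Vθ s x) → (∫ x, ((Vρ 0 x - ρ 0 x) ^ 2 + ‖Vm 0 x - ρ 0 x • u 0 x‖ ^ 2 + (VE 0 x - Literature.MathematicalPhysics.KineticTheory.totalEnergyDensity (ρ 0 x) (u 0 x) (θ 0 x)) ^ 2)) ≤ δ → (∀ s ∈ Set.Icc 0 t, (∫ x, -(Vρ s x * (3 / 2 * Real.log (Vθ s x) - Real.log (Vρ s x) - Literature.MathematicalPhysics.KineticTheory.hsExcessFreeEnergy (Vρ s x * σ ^ 3)))) ≤ (∫ x, -(ρ 0 x * (3 / 2 * Real.log (θ 0 x) - Real.log (ρ 0 x) - Literature.MathematicalPhysics.KineticTheory.hsExcessFreeEnergy (ρ 0 x * σ ^ 3)))) + δ) → (∀ i, ∀ s ∈ Set.Icc 0 t, |(∫ x, Vρ s x * Ψρ i s x) - (∫ x, Vρ 0 x * Ψρ i 0 x) - ∫ r in (0 : ℝ)..s, ∫ x, (Vρ r x * Literature.Analysis.FunctionSpaces.Torus.timeDerivWithin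 (Set.Icc 0 t) (Ψρ i) r x + inner ℝ (Vm r x) (Literature.Analysis.FunctionSpaces.Torus.gradient (Ψρ i r) x))| ≤ δ ∧ |(∫ x, VE s x * ΨE i s x) - (∫ x, VE 0 x * ΨE i 0 x) - ∫ r in (0 : ℝ)..s, ∫ x, (VE r x * Literature.Analysis.FunctionSpaces.Torus.timeDerivWithin (Set.Icc 0 t) (ΨE i) r x + (VE r x + Vp r x) / Vρ r x * inner ℝ (Vm r x) (Literature.Analysis.FunctionSpaces.Torus.gradient (ΨE i r) x))| ≤ δ ∧ |(∫ x, inner ℝ (Vm s x) (Ψm i s x)) - (∫ x, inner ℝ (Vm 0 x) (Ψm i 0 x)) - ∫ r in (0 : ℝ)..s, ∫ x, (inner ℝ (Vm r x) (Literature.Analysis.FunctionSpaces.Torus.timeDerivWithin (Set.Icc 0 t) (Ψm i) r x) + inner ℝ (Vm r x) (Literature.Analysis.FunctionSpaces.Torus.fderiv (Ψm i r) x (Vm r x)) / Vρ r x + Vp r x * Literature.Analysis.FunctionSpaces.Torus.divergence (Ψm i r) x)| ≤ δ) → ∀ s ∈ Set.Icc 0 t, (∫ x, ((Vρ s x - ρ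 s x) ^ 2 + ‖Vm s x - ρ s x • u s x‖ ^ 2 + (VE s x - Literature.MathematicalPhysics.KineticTheory.totalEnergyDensity (ρ s x) (u s x) (θ s x)) ^ 2)) ≤ ε

/-- item stmt-AtomisticToContinuum-6956 · crux · rank 5 · closed · moot by None · by planner
why it might fail: Needs the LD upper bound for coarse-grained (ρ,m,E) profiles of the canonical hard-sphere gas on dilute boxes with rate βE − S_hs (Georgii1994-type) plus a slab-partition transfer to local-Gibbs tilts; any leak in the exponent bookkeeping (momentum shells, kernel G) must stay below δ.
sources: Georgii1994, GoldsteinLebowitz2004, GarridoGoldsteinLebowitz2004, doi:10.1103/physrevlett.92.050602, Ruelle1969, LebowitzPenrose1964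
[crux] (card A4, pathwise second law in probability) same guarded prefix; for every FIXED continuous
kernel G ≥ 0 with ∫G = 1, t < T, δ > 0 and dilute box (c, C_ρ, C) with C_ρσ³ < η₀: the local-Gibbs
probability that the G-mollified empirical fields at time t lie in the box everywhere AND their
coarse-grained hard-sphere entropy ∫ρ_G(3/2 log θ_G − log ρ_G − f_ex(ρ_Gσ³)) is below the initial
macroscopic entropy ∫ρ̄₀(3/2 log θ̄₀ − log ρ̄₀ − f_ex(ρ̄₀σ³)) − δ tends to 0. Mechanism:
Boltzmann–Einstein typicality — static large deviations of coarse-grained (ρ,m,E) profiles under the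
flow-INVARIANT canonical Gibbs measure (rate βE − S_hs), transferred to local-Gibbs data using
dP₀/dλ = exp((N+1)·linear functional of the initial empirical fields) and pathwise energy
conservation (exponent gap = δ). Differs from EntropyBookkeeping.MacroSecondLaw (stmt-4514):
specialised to the flow map, boxed (dilute) instead of density-floored, and benchmarked on the Euler
data (ρ,u,θ)(0) so that no local-Gibbs LLN fact is needed in the assembly; 4514 together with
localGibbs_lln implies it, so either closes X4. [difficulty: L] -/
@[route_item "route-AtomisticToContinuum-StatisticalGermanoSplit"]
def EntropyTypicality : Prop :=
  ∃ η₀ : ℝ, 0 < η₀ ∧ ∀ (a₀ θ₀ : Literature.MathematicalPhysics.KineticTheory.T3 → ℝ) (u₀ : Literature.MathematicalPhysics.KineticTheory.T3 → Literature.MathematicalPhysics.KineticTheory.V3), Continuous a₀ → Continuous θ₀ → Continuous u₀ → (∀ x, 0 < a₀ x) → (∀ x, 0 < θ₀ x) → ∃ σ₀ : ℝ, 0 < σ₀ ∧ ∀ σ : ℝ, 0 < σ → σ < σ₀ → ∀ (T : ℝ) (ρ θ : ℝ → Literature.MathematicalPhysics.KineticTheory.T3 → ℝ) (u : ℝ →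 Literature.MathematicalPhysics.KineticTheory.T3 → Literature.MathematicalPhysics.KineticTheory.V3), Literature.MathematicalPhysics.KineticTheory.IsHardSphereEulerSolution σ T ρ u θ → (∀ t ∈ Set.Ico 0 T, ∀ x, ρ t x * σ ^ 3 < η₀) → ∀ Φ : (N : ℕ) → Literature.Analysis.FluidPDE.HardSphereFlow (Literature.Analysis.FluidPDE.Torus.geometry (Fin 3)) (Literature.MathematicalPhysics.KineticTheory.hsDiameter σ N) (N + 1), Literature.MathematicalPhysics.KineticTheory.TendstoHydroFieldsAt (fun N => Literature.MathematicalPhysics.KineticTheory.localGibbsLaw σ a₀ u₀ θ₀ N (Φ N)) Φ ρ u θ 0 → ∀ G : Literature.MathematicalPhysics.KineticTheory.T3 → ℝ, Continuous G → (∀ x, 0 ≤ G x) → (∫ x, G x = 1) → ∀ t ∈ Set.Ico 0 T, ∀ (δ c Cρ C : ℝ), 0 < δ → 0 < c → Cρ * σ ^ 3 < η₀ → Filter.Tendsto (fun N : ℕ => Literature.MathematicalPhysics.KineticTheory.localGibbsLaw σ a₀ u₀ θ₀ N (Φ N) {z | let ρG := fun x => Literature.MathematicalPhysics.KineticTheory.empiricalDensityField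 ((Φ N).flow t z) (fun y => G (x - y)); let mG := fun x => Literature.MathematicalPhysics.KineticTheory.empiricalMomentumField ((Φ N).flow t z) (fun y => G (x - y)); let EG := fun x => Literature.MathematicalPhysics.KineticTheory.empiricalEnergyField ((Φ N).flow t z) (fun y => G (x - y)); let θG := fun x => 2 / 3 * (EG x / ρG x - ‖mG x‖ ^ 2 / (2 * ρG x ^ 2)); (∀ x, c ≤ ρG x ∧ ρG x ≤ Cρ ∧ ‖mG x‖ ≤ C ∧ EG x ≤ C ∧ c ≤ θG x) ∧ (∫ x, ρG x * (3 / 2 * Real.log (θG x) - Real.log (ρG x) - Literature.MathematicalPhysics.KineticTheory.hsExcessFreeEnergy (ρG x * σ ^ 3))) < (∫ x, ρ 0 x * (3 / 2 * Real.log (θ 0 x) - Real.log (ρ 0 x) - Literature.MathematicalPhysics.KineticTheory.hsExcessFreeEnergy (ρ 0 x * σ ^ 3))) - δ}) Filter.atTop (nhds 0)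

/-- item stmt-AtomisticToContinuum-6957 · crux · rank 6 · closed · moot by None · by planner
why it might fail: A sup over (s,x) of block observables at scale ℓ_N is a DYNAMIC moderate-deviation statement: static typicality only reaches events rarer than exp(−N·I(U₀)) while block tails are exp(−cNℓ_N³); one transient pocket of size ℓ_N with non-vanishing probability refutes it.
sources: Spohn1991, OllaVaradhanYau1993, KipnisLandim1999, GarridoGoldsteinLebowitz2004, doi:10.1103/physrevlett.92.050602
[crux] (card SS4, tails) for every target band η₀ > 0 and profiles ∃ σ₀ ∀ σ < σ₀, for every guarded
classical solution, admissible kinetic filter and t < T there are 0 < c, C_ρ, C with C_ρσ³ < η₀, the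
classical solution strictly inside the box on [0,t], and local-Gibbs probability → 1 that the
mollified empirical fields U_N^{ℓ_N}(s,x) stay in the box {c ≤ ρ ≤ C_ρ, |m| ≤ C, E ≤ C, θ ≥ c} for
ALL s ≤ t and x ∈ 𝕋³ (no mesoscopic vacuum, hot or dense pockets are created by the dynamics before
T). [difficulty: XL] -/
@[route_item "route-AtomisticToContinuum-StatisticalGermanoSplit"]
def KineticRangeControl : Prop :=
  ∀ η₀ : ℝ, 0 < η₀ → ∀ (a₀ θ₀ : Literature.MathematicalPhysics.KineticTheory.T3 → ℝ) (u₀ : Literature.MathematicalPhysics.KineticTheory.T3 → Literature.MathematicalPhysics.KineticTheory.V3), Continuous a₀ → Continuous θ₀ → Continuous u₀ → (∀ x, 0 < a₀ x) → (∀ x, 0 < θ₀ x) → ∃ σ₀ : ℝ, 0 < σ₀ ∧ ∀ σ : ℝ, 0 < σ → σ < σ₀ → ∀ (T : ℝ) (ρ θ : ℝ → Literature.MathematicalPhysics.KineticTheory.T3 → ℝ) (u : ℝ → Literature.MathematicalPhysics.KineticTheory.T3 → Literature.MathematicalPhysics.KineticTheory.V3), Literature.MathematicalPhysics.KineticTheory.IsHardSphereEulerSolution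 σ T ρ u θ → (∀ t ∈ Set.Ico 0 T, ∀ x, ρ t x * σ ^ 3 < η₀) → ∀ Φ : (N : ℕ) → Literature.Analysis.FluidPDE.HardSphereFlow (Literature.Analysis.FluidPDE.Torus.geometry (Fin 3)) (Literature.MathematicalPhysics.KineticTheory.hsDiameter σ N) (N + 1), Literature.MathematicalPhysics.KineticTheory.TendstoHydroFieldsAt (fun N => Literature.MathematicalPhysics.KineticTheory.localGibbsLaw σ a₀ u₀ θ₀ N (Φ N)) Φ ρ u θ 0 → ∀ (φ : ℕ → Literature.MathematicalPhysics.KineticTheory.T3 → ℝ) (ℓ : ℕ → ℝ), (∀ N, Continuous (φ N)) → (∀ N x, 0 ≤ φ N x) → (∀ N, ∫ x, φ N x = 1) → (∀ N x, ℓ N < Literature.Analysis.FluidPDE.Torus.euclidDist x 0 → φ N x = 0) → (∃ A : ℝ, ∀ N x y, φ N x * ℓ N ^ 3 ≤ A ∧ |φ N x - φ N y| * ℓ N ^ 4 ≤ A * Literature.Analysis.FluidPDE.Torus.euclidDist x y) → (∀ N, 0 < ℓ N) → Filter.Tendsto ℓ Filter.atTop (nhds 0) → Filter.Tendsto (fun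 N : ℕ => ((N : ℝ) + 1) * ℓ N ^ 3 / Real.log ((N : ℝ) + 2)) Filter.atTop Filter.atTop → ∀ t ∈ Set.Ico 0 T, ∃ c Cρ C : ℝ, 0 < c ∧ Cρ * σ ^ 3 < η₀ ∧ (∀ s ∈ Set.Icc 0 t, ∀ x, c < ρ s x ∧ ρ s x < Cρ ∧ ‖ρ s x • u s x‖ < C ∧ Literature.MathematicalPhysics.KineticTheory.totalEnergyDensity (ρ s x) (u s x) (θ s x) < C ∧ c < θ s x) ∧ Filter.Tendsto (fun N : ℕ => Literature.MathematicalPhysics.KineticTheory.localGibbsLaw σ a₀ u₀ θ₀ N (Φ N) {z | let ρℓ := fun s x => Literature.MathematicalPhysics.KineticTheory.empiricalDensityField ((Φ N).flow s z) (fun y => φ N (x - y)); let mℓ := fun s x => Literature.MathematicalPhysics.KineticTheory.empiricalMomentumField ((Φ N).flow s z) (fun y => φ N (x - y)); let Eℓ := fun s x => Literature.MathematicalPhysics.KineticTheory.empiricalEnergyField ((Φ N).flow s z) (fun y => φ N (x - y)); let θℓ := fun s x => 2 / 3 * (Eℓ s x / ρℓ s x - ‖mℓ s x‖ ^ 2 /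 (2 * ρℓ s x ^ 2)); ∃ s ∈ Set.Icc 0 t, ∃ x, ¬ (c ≤ ρℓ s x ∧ ρℓ s x ≤ Cρ ∧ ‖mℓ s x‖ ≤ C ∧ Eℓ s x ≤ C ∧ c ≤ θℓ s x)}) Filter.atTop (nhds 0)

/-- item stmt-AtomisticToContinuum-0768 · support · rank 9 · open · by planner
sources: Ruelle1969, LebowitzPenrose1964
[support] Hard-sphere equation of state at low density: ∃ η₀ > 0 and F real-analytic on (−η₀, η₀)
with hsExcessFreeEnergy = F on [0, η₀), F(0) = 0, F'(0) = 2π/3 (second virial coefficient of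
unit-diameter spheres), and the canonical thermodynamic limit −N⁻¹ log hsFreeVolume η N → F(η)
exists (not just limsup) for η ∈ [0, η₀). Ruelle1969 §3.4 (existence), LebowitzPenrose1964
(convergence of the virial expansion ⇒ analyticity). Makes hsCompressibility/hsPressure smooth and
Z(η) = 1 + (2π/3)η + O(η²); needed by every route (hyperbolicity of the Euler system, virial
theorem). -/
@[route_item "route-AtomisticToContinuum-StatisticalGermanoSplit"]
def HsEosLowDensity : Prop :=
  ∃ η₀ : ℝ, 0 < η₀ ∧ ∃ F : ℝ → ℝ, AnalyticOnNhd ℝ F (Set.Ioo (-η₀) η₀) ∧ Set.EqOn Literature.MathematicalPhysics.KineticTheory.hsExcessFreeEnergy F (Set.Ico 0 η₀) ∧ F 0 = 0 ∧ deriv F 0 = 2 * Real.pi / 3 ∧ ∀ η ∈ Set.Ico 0 η₀, Filter.Tendsto (fun N : ℕ => -(N : ℝ)⁻¹ * Real.log (Literature.MathematicalPhysics.KineticTheory.hsFreeVolume η N)) Filter.atTop (nhds (F η))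

/-- item stmt-AtomisticToContinuum-3091 · support · rank 9 · open · by planner
sources: Sideris1985, Spohn1991, Kato1975
[crux] (card crux 1B ∪ 3; the hidden PDE crux of every route) for every η > 0 and all continuous
positive profiles there is σ₀ > 0 such that for 0 < σ < σ₀, every classical hard-sphere-Euler
solution on [0,T) whose t = 0 fields are the LLN limit of the local Gibbs laws satisfies ρ_t(x)σ³ <
η for all t < T and x — i.e. limsup_{σ→0} σ³ sup_{t<T*_σ} ‖ρ_σ(t)‖_∞ = 0 profile by profile. For
profiles whose ideal-gas development is global or breaks by a non-degenerate shock (Luk–Speck /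
Buckmaster–Shkoller–Vicol open sets) this is stability of shock formation under an O(σ³)
equation-of-state and data perturbation; in general it is a σ-uniform density bound at the FIRST
singularity of 3-D compressible Euler for all smooth data. [deps: EosContinuity,
LocalGibbsDensityLimit] [difficulty: open-problem] -/
@[route_item "route-AtomisticToContinuum-StatisticalGermanoSplit"]
def DiluteSelfConsistency : Prop :=
  ∀ η : ℝ, 0 < η → ∀ (a₀ θ₀ : Literature.MathematicalPhysics.KineticTheory.T3 → ℝ) (u₀ : Literature.MathematicalPhysics.KineticTheory.T3 → Literature.MathematicalPhysics.KineticTheory.V3), Continuous a₀ → Continuous θ₀ → Continuous u₀ → (∀ x, 0 < a₀ x) → (∀ x, 0 < θ₀ x) → ∃ σ₀ : ℝ, 0 < σ₀ ∧ ∀ σ : ℝ, 0 < σ → σ < σ₀ → ∀ (T : ℝ) (ρ θ : ℝ → Literature.MathematicalPhysics.KineticTheory.T3 → ℝ) (u : ℝ → Literature.MathematicalPhysics.KineticTheory.T3 → Literature.MathematicalPhysics.KineticTheory.V3), Literature.MathematicalPhysics.KineticTheory.IsHardSphereEulerSolution σ T ρ u θ → ∀ Φ : (N : ℕ) → Literature.Analysis.FluidPDE.HardSphereFlow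 (Literature.Analysis.FluidPDE.Torus.geometry (Fin 3)) (Literature.MathematicalPhysics.KineticTheory.hsDiameter σ N) (N + 1), Literature.MathematicalPhysics.KineticTheory.TendstoHydroFieldsAt (fun N => Literature.MathematicalPhysics.KineticTheory.localGibbsLaw σ a₀ u₀ θ₀ N (Φ N)) Φ ρ u θ 0 → ∀ t ∈ Set.Ico 0 T, ∀ x, ρ t x * σ ^ 3 < η

/-- item stmt-AtomisticToContinuum-3093 · support · rank 9 · closed · moot by None · by planner
sources: Spohn1991, OllaVaradhanYau1993
[support] [support, NOT staffed by this route] the packing-guarded conjunct: ∃ η₀ > 0 such that for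
all continuous positive profiles ∃ σ₀ ∀ σ ∈ (0,σ₀) ∀ classical hard-sphere-Euler solutions on [0,T)
WITH ρ_t(x)σ³ < η₀ on [0,T) × 𝕋³ and all flow families, LLN of the fields at t = 0 ⇒ LLN at every t
< T. This is what the five positive routes deliver in substance (their inputs
LocalGibbsConcentration 0767 / HsEosLowDensity 0768 live at local packing < η₀); the audit's D5
variant HydrodynamicLimitInBand (∀ σ < 1/2 form) implies it. Filed typed so tenure planners can
re-target RelEntropyVanishing / L2HydroFields to guarded versions. [difficulty: open-problem] -/
@[route_item "route-AtomisticToContinuum-StatisticalGermanoSplit"]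
def HydroLimitInBand : Prop :=
  ∃ η₀ : ℝ, 0 < η₀ ∧ ∀ (a₀ θ₀ : Literature.MathematicalPhysics.KineticTheory.T3 → ℝ) (u₀ : Literature.MathematicalPhysics.KineticTheory.T3 → Literature.MathematicalPhysics.KineticTheory.V3), Continuous a₀ → Continuous θ₀ → Continuous u₀ → (∀ x, 0 < a₀ x) → (∀ x, 0 < θ₀ x) → ∃ σ₀ : ℝ, 0 < σ₀ ∧ ∀ σ : ℝ, 0 < σ → σ < σ₀ → ∀ (T : ℝ) (ρ θ : ℝ → Literature.MathematicalPhysics.KineticTheory.T3 → ℝ) (u : ℝ → Literature.MathematicalPhysics.KineticTheory.T3 → Literature.MathematicalPhysics.KineticTheory.V3), Literature.MathematicalPhysics.KineticTheory.IsHardSphereEulerSolution σ T ρ u θ → (∀ t ∈ Set.Ico 0 T, ∀ x, ρ t x * σ ^ 3 < η₀) → ∀ Φ : (N : ℕ) → Literature.Analysis.FluidPDE.HardSphereFlow (Literature.Analysis.FluidPDE.Torus.geometry (Fin 3)) (Literature.MathematicalPhysics.KineticTheory.hsDiameter σ N) (N + 1), Literature.MathematicalPhysics.KineticTheory.TendstoHydroFieldsAt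 (fun N => Literature.MathematicalPhysics.KineticTheory.localGibbsLaw σ a₀ u₀ θ₀ N (Φ N)) Φ ρ u θ 0 → ∀ t ∈ Set.Ico 0 T, Literature.MathematicalPhysics.KineticTheory.TendstoHydroFieldsAt (fun N => Literature.MathematicalPhysics.KineticTheory.localGibbsLaw σ a₀ u₀ θ₀ N (Φ N)) Φ ρ u θ t

/-- item stmt-AtomisticToContinuum-6958 · support · rank 9 · closed · moot by None · by planner
sources: FjordholmEtAl2020, Germano2007, doi:10.1063/1.2714078, Dafermos1979, ConstantinETiti1994
[support] (this route's assembly proper; provable now from the five cruxes, standard but long)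
KineticFilterConsistency → MesoQuiescence → FilteredEntropyStability → EntropyTypicality →
KineticRangeControl → HydroLimitInBand. Proof plan: fix ε; FES gives δ and test functions Ψ_i =
Dη(Ū)-type; choose an even bump G = G_{ℓ₂} with ℓ₂ so small that ‖Ū₀∗G − Ū₀‖ and the MesoQuiescence
radius are below δ; run FES pathwise on V = U_N^{ℓ_N}∗G on the intersection of the good events:
residuals of V against Ψ_i = residuals of U_N^{ℓ_N} against G∗Ψ_i (Germano, KFC) + Leonard terms ≤
C_K·structure function (Taylor on the box, MQ, Fubini/Markov in (h,h′)); entropy from ET at kernel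
φ_{ℓ_N}∗G ≈ G; box from KRC (convexity of the box under averaging); initial term from the LLN
hypothesis; then ‖V(t) − Ū(t)‖_{L²} ≤ ε w.h.p. and testing against continuous χ (uniform continuity,
mass/energy bounds) gives TendstoHydroFieldsAt; η₀ := min of the cruxes' η₀, σ₀ := min of their σ₀.
[deps: KineticFilterConsistency, MesoQuiescence, FilteredEntropyStability, EntropyTypicality,
KineticRangeControl, HydroLimitInBand] [difficulty: L] -/
@[route_item "route-AtomisticToContinuum-StatisticalGermanoSplit"]
def PhysicsToInBand : Prop :=
  KineticFilterConsistency → MesoQuiescence → FilteredEntropyStability → EntropyTypicality → KineticRangeControl → HydroLimitInBand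

/-- item stmt-AtomisticToContinuum-6959 · assembly · rank 1 · closed · moot by None · by planner
sources: Spohn1991, FjordholmEtAl2020, Dafermos1979
[assembly] KineticFilterConsistency → MesoQuiescence → FilteredEntropyStability → EntropyTypicality
→ KineticRangeControl → DiluteSelfConsistency → HydrodynamicLimit (via PhysicsToInBand and the
ImplosionLoophole bookkeeping DiluteSelfConsistency → HydroLimitInBand → HydrodynamicLimit). -/
@[route_item "route-AtomisticToContinuum-StatisticalGermanoSplit"]
def Assembly : Prop :=
  KineticFilterConsistency → MesoQuiescence → FilteredEntropyStability → EntropyTypicality → KineticRangeControl → DiluteSelfConsistency → Literature.MathematicalPhysics.KineticTheory.HydrodynamicLimit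

end Summit.AtomisticToContinuum.HydrodynamicLimit.Theses.StatisticalGermanoSplit
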